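import Literature.NumberTheory.Automorphic.AutomorphicRepsGL
import Literature.NumberTheory.Automorphic.AutomorphicLFunction
import Literature.NumberTheory.GaloisRepresentations.IntegralGaloisActionProofs
import HarnessLib

/-!
# The twisted Hecke theory of cuspidal `GL(2)` (Jacquet–Langlands 1970, Thm. 11.1 / Cor. 11.2) — the named fact

Topic `Literature/NumberTheory/Automorphic`. ONE named fact (D-0014), no proofs:
`JacquetLanglands1970_twistedHeckeTheoryGL2`, VERBATIM the hypothesis binder `HT` of the accepted
reduction `Literature.NumberTheory.Automorphic.frobSatakeCompatibleAt_of_isPiOfArtinRep_both_of_heckeTheoryGL2`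
(`PiOfArtinRepHeckeTheoryOnlyProofs.lean` ll. 77–122, p116514) — librarian sweep g24,
vend-from-binder, promote events 3389241 / 3405381 (the provefact seat may not mint it,
`lint.fact-fanout`). First consumer: that reduction, whence BOTH named facts
`frobSatakeCompatibleAt_of_isPiOfArtinRep` and `…_of_isUnramifiedAt` (Gelbart 1997, Prop. 4.1) follow:
`(frobSatakeCompatibleAt_of_isPiOfArtinRep_both_of_heckeTheoryGL2 JacquetLanglands1970_twistedHeckeTheoryGL2_holds).1/.2`.

## Source and reading

Jacquet–Langlands, *Automorphic Forms on GL(2)* (LNM 114, 1970), Thm. 11.1 and Cor. 11.2 (the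
global Hecke theory of a cuspidal `π` on `GL₂(𝔸_F)` twisted by the idele class / Galois characters
`χ`: entire completed `L`-functions `Λ(s, π ⊗ χ)`, `Λ(s, π̃ ⊗ χ⁻¹)` with Euler products of local
degree `≤ 2` in a right half-plane, archimedean factors with finitely many zero ordinates, a
functional equation `Λ(s) = ε(s) Λ'(1 − s)` with nowhere-vanishing `ε`), together with the local
dictionary of Thm. 2.18, Props. 3.5, 3.6, 3.8(i) and Lemma 3.9: at places where `π` has Satake
parameter `α` and `χ` is unramified the local polynomials are `eulerPolynomial (α · χ(Frob))` and
its contragredient twin; under ramified twist they are `1`; a twist ramified deeper than a bound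
`Nπ u` kills the local factor; and "local degree `2` with `χ` trivial at `u` ⟹ `π_u` unramified with
Satake parameter read off the polynomial". Read for the Borel–Jacquet datum
`CuspidalAutomorphicRepData 2 F hcpt` of the tree; Gelbart 1997 Prop. 4.1 (with Thm. 3.2,
Example 3.2.3) is the consumer.

What is deliberately NOT here: Whittaker models, the construction of `Λ` as a Mellin transform,
converse theorems.

## Status

PROVED in the tree: `theorem JacquetLanglands1970_twistedHeckeTheoryGL2_holds` (no binders) lives in the
sibling `TwistedHeckeTheoryGL2Proofs.lean` (p162051), obtained from the archimedean Gamma-product input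
`archKirillovGammaProduct` (`ArchHeckeTestVectorGammaGL2.lean`, Jacquet–Langlands Thm. 5.15 / Thm. 6.4)
through the accepted reduction chain `(A_GP) ⇒ (A_Γ) ⇒ JacquetLanglands1970_standardLTheoryGL2 ⇒` this
fact (the statement of the fact is unchanged since it was vendored).
-/

noncomputable section

open scoped NumberField nonZeroDivisors
open NumberField IsDedekindDomain Field Filter Topology Set

namespace Literature.NumberTheory.Automorphic

/-- **Jacquet–Langlands 1970, Thm. 11.1 / Cor. 11.2 with Thm. 2.18, Props. 3.5, 3.6, 3.8(i),
Lemma 3.9: the twisted Hecke theory of a cuspidal automorphic representation of `GL₂(𝔸_F)`.** For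
every number field `F`, compact-level datum `hcpt` and cuspidal `π : CuspidalAutomorphicRepData 2 F hcpt`
there is a conductor bound `Nπ : places → ℕ` such that for every continuous character
`χ : Γ_F →ₜ* ℂˣ` there are local polynomials `P P' : places → ℂ[X]` (constant term `1`, degree `≤ 2`),
meromorphic `Λ Λ'`, entire `Γ Γ'` with finitely many zero ordinates, a continuous nowhere-zero
`ε` and `c ≥ 1` with: Euler products `Λ s · Γ s = ∏' u (P u (q_u^{-s}))⁻¹` (and the primed twin) for
`re s > c`; the functional equation `Λ s = ε s · Λ' (1 - s)`; the unramified dictionary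
`P u = eulerPolynomial (α · χ(Frob_𝔓))`, `P' u = eulerPolynomial (α⁻¹ · χ(Frob_𝔓)⁻¹)` where `π` has
Satake parameter `α` at `u` and `χ` is unramified at `u`; `P u = P' u = 1` when `π` is unramified
at `u` but `χ` ramifies there, or when `χ` ramifies at `u` deeper than `Nπ u`; and, for `χ`
unramified AND trivial on Frobenius at `u`, `deg P u = 2 ⟹` `π` has a zero-free Satake parameter
`B` at `u` with `P u = eulerPolynomial B`. VERBATIM the binder `HT` of
`frobSatakeCompatibleAt_of_isPiOfArtinRep_both_of_heckeTheoryGL2`; users take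
`(HT : JacquetLanglands1970_twistedHeckeTheoryGL2)`. Named fact (D-0014), PROVED in the tree:
feed users `JacquetLanglands1970_twistedHeckeTheoryGL2_holds` (`TwistedHeckeTheoryGL2Proofs.lean`).
[cite: JacquetLanglands1970, Thm. 11.1 and Cor. 11.2, with Thm. 2.18, Props. 3.5, 3.6, 3.8(i) and Lemma 3.9]
[cite: Gelbart1997, Prop. 4.1 (the consumer), Thm. 3.2 and Example 3.2.3] -/
def JacquetLanglands1970_twistedHeckeTheoryGL2 : Prop :=
  ∀ {F : Type} [Field F] [NumberField F] (hcpt : isCompact_glFiniteIntegralLevel 2 F)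
    (π : CuspidalAutomorphicRepData 2 F hcpt),
    ∃ Nπ : HeightOneSpectrum (𝓞 F) → ℕ, ∀ χ : absoluteGaloisGroup F →ₜ* ℂˣ,
    ∃ (P P' : HeightOneSpectrum (𝓞 F) → Polynomial ℂ) (Λ Λ' Γ Γ' ε : ℂ → ℂ) (c : ℝ),
      (∀ u, (P u).eval 0 = 1 ∧ (P u).natDegree ≤ 2) ∧
      (∀ u, (P' u).eval 0 = 1 ∧ (P' u).natDegree ≤ 2) ∧
      Meromorphic Λ ∧ Meromorphic Λ' ∧ Differentiable ℂ Γ ∧ Differentiable ℂ Γ' ∧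
      (∃ Y : Set ℝ, Y.Finite ∧ ∀ s, Γ s = 0 → s.im ∈ Y) ∧
      (∃ Y : Set ℝ, Y.Finite ∧ ∀ s, Γ' s = 0 → s.im ∈ Y) ∧
      Continuous ε ∧ (∀ s, ε s ≠ 0) ∧ 1 ≤ c ∧
      (∀ s : ℂ, c < s.re →
        (Multipliable fun u : HeightOneSpectrum (𝓞 F) =>
            ((P u).eval ((u.residueCard : ℂ) ^ (-s)))⁻¹) ∧
          (∀ u, (P u).eval ((u.residueCard : ℂ) ^ (-s)) ≠ 0) ∧
          Λ s * Γ s =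
            ∏' u : HeightOneSpectrum (𝓞 F), ((P u).eval ((u.residueCard : ℂ) ^ (-s)))⁻¹) ∧
      (∀ s : ℂ, c < s.re →
        (Multipliable fun u : HeightOneSpectrum (𝓞 F) =>
            ((P' u).eval ((u.residueCard : ℂ) ^ (-s)))⁻¹) ∧
          (∀ u, (P' u).eval ((u.residueCard : ℂ) ^ (-s)) ≠ 0) ∧
          Λ' s * Γ' s =
            ∏' u : HeightOneSpectrum (𝓞 F), ((P' u).eval ((u.residueCard : ℂ) ^ (-s)))⁻¹) ∧
      (∀ s, Λ s = ε s * Λ' (1 - s)) ∧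
      (∀ (u : HeightOneSpectrum (𝓞 F)) (α : Multiset ℂ), π.1.HasSatakeParamAt u α →
        (∀ 𝔓 ∈ u.primesAbove, ∀ g ∈ 𝔓.inertia (absoluteGaloisGroup F), χ g = 1) →
        ∀ 𝔓 ∈ u.primesAbove, ∀ g : absoluteGaloisGroup F, IsArithFrobAt (𝓞 F) g 𝔓 →
          P u = eulerPolynomial (α.map fun a => a * (χ g : ℂ)) ∧
            P' u = eulerPolynomial (α.map fun a => a⁻¹ * (χ g : ℂ)⁻¹)) ∧
      (∀ (u : HeightOneSpectrum (𝓞 F)) (α : Multiset ℂ), π.1.HasSatakeParamAt u α →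
        (∃ 𝔓 ∈ u.primesAbove, ∃ g ∈ 𝔓.inertia (absoluteGaloisGroup F), χ g ≠ 1) →
          P u = 1 ∧ P' u = 1) ∧
      (∀ u : HeightOneSpectrum (𝓞 F),
        (∀ 𝔓 ∈ u.primesAbove, ∃ g ∈ 𝔓.inertia (absoluteGaloisGroup F),
          ∀ k : ℕ, 0 < k → k ≤ Nπ u → χ g ^ k ≠ 1) → P u = 1 ∧ P' u = 1) ∧
      (∀ u : HeightOneSpectrum (𝓞 F),
        (∀ 𝔓 ∈ u.primesAbove, ∀ g ∈ 𝔓.inertia (absoluteGaloisGroup F), χ g = 1) →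
        (∀ 𝔓 ∈ u.primesAbove, ∀ g : absoluteGaloisGroup F,
          IsArithFrobAt (𝓞 F) g 𝔓 → χ g = 1) →
        (P u).natDegree = 2 →
          ∃ B : Multiset ℂ, (0 : ℂ) ∉ B ∧ P u = eulerPolynomial B ∧
            π.1.HasSatakeParamAt u B)

end Literature.NumberTheory.Automorphic

end
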